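import Summits.CriticalPhenomena.Ising3DConformalLimit.Theorems.FKParityRobustnessStrandShadowComposition
import Summits.CriticalPhenomena.Ising3DConformalLimit.Theorems.FKParityRobustnessStrandShadowPairSplit
import Summits.CriticalPhenomena.Ising3DConformalLimit.Theorems.FKParityRobustnessStrandShadowCleanGlue
import Literature.Probability.LatticeModels.ThermodynamicLimit
import HarnessLib

/-!
# `StrandShadow` for all large `l` from the lattice clause (iii) INT
# (support theorem for the crux `StrandShadow`, stmt-CriticalPhenomena-14626)

The formal crux `StrandShadow` is `∃ c > 0, ∀ l ≥ 1, ∃ N₀, ∀ N ≥ N₀, LHS(l,N) ≤ (1 - c)·Z₀₁·G₂₃` on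
`l·tetra ⊂ Λ_N` at `β_c(3)`, where (Disproof §1, `StrandShadowSketch.lhs_decomposition'`)
`LHS = LHS_clean + J` splits into the intended clean sum and the JUNK term
`J = Σ_{F ∈ 𝒯₀₁ : a₂, a₃ ∈ V(K_{a₀}F)} t^{|F|}` produced by the free `isingCorr` of the depleted
volume taking the value `1` when the `a₀`-cluster swallows both `a₂` and `a₃`.

This file makes the standing diagnosis of the crux ("`StrandShadow` = C′ ∧ a small-`l` numerical
fact; C′ ⟺ INT") a theorem in its positive direction:

* `strandShadow_eventually_of_INT_of_junkRatio` — INT with constant `c` (the lattice clause (iii)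
  at the tetrahedron: `2c·G₀₁G₂₃ ≤ ΣGG − ⟨σ_A⟩` uniformly) AND a junk ratio bound
  `J ≤ (C/l)·Z₀₁·G₂₃` (the registered helper `junkRatio_lattice_le` of the line
  `odd-cluster-cut-exact-helper`: `J·Z∅ ≤ Z_A·Z₂₃`, Lebowitz, symmetry, infrared bound) give the
  crux inequality with constant `c/3` for EVERY `l ≥ l₀ = ⌈3C/c⌉ + 1` (and all large `N`):
  `LHS_clean ≤ (1 − (2/3)c)·Z₀₁·G₂₃` by the landed `StrandShadowSketch.clean_core` ((★) pair split
  `stub_pairSplit` + three clean pairings `stub_threeClean` + tetrahedral symmetry `stub_symmetry`),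
  and `J ≤ (C/l)·Z₀₁G₂₃ ≤ (c/3)·Z₀₁G₂₃`.

The two structural inputs three-clean (`StrandShadowSketch.stub_threeClean`, landed p86528) and tetrahedral
symmetry (`StrandShadowSketch.stub_symmetry`, landed p87103) enter as HYPOTHESES `hTC`, `hSY` stated verbatim,
because the hub has had no olean for those two accepted modules since 06:46Z (every importer is refused
`remote:stale:unbuilt`); discharge them by name once the modules are built.

So, granted INT, what separates the formal crux from a theorem is exactly the finitely many scales
`1 ≤ l < l₀`, where the inequality is a numerical fact about the critical state (MC j013016:
margin ≈ 0.3 against junk ≈ 0.05 at `l = 1`).  Theorem-only file; no new definitions.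
-/

noncomputable section

open Finset SimpleGraph
open Literature.Probability.LatticeModels
open Summit.CriticalPhenomena.Ising3DConformalLimit.Theorems

namespace Summit.CriticalPhenomena.Ising3DConformalLimit.Theorems.StrandShadowOddCut

open scoped Classical

section Assemble

variable {V : Type*} [Fintype V] [DecidableEq V] (G : SimpleGraph V) [DecidableRel G.Adj]

/-- **Assembly at one scale (generic finite graph)**: (★) (`hps`), three-clean (`htc`), symmetry
(`hsym`) and INT with constant `c` (`hINT`) give the clean part `LHS_clean ≤ (1 − (2/3)c)·Z₀₁·G₂₃`
(the argument of `StrandShadowSketch.clean_core`, p91130), the junk split `LHS = LHS_clean + J`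
(the argument of `StrandShadowSketch.lhs_decomposition'`, Disproof §1) and a junk bound `J ≤ κ·Z₀₁·G₂₃`
with `κ ≤ c/3` give the formal shadow inequality with constant `c/3`.  The two landed arguments are
re-run INLINE (not imported): their module's `Finset.filter` decidability instances are not
definitionally the ones elaborated here, so their statements cannot be instantiated against these
terms (whnf timeout) — the same reason the planners' skeletons re-elaborate them. -/
theorem evINT_assemble {β c κ : ℝ} (hβ : 0 ≤ β) (hκ : κ ≤ c / 3) (a : Fin 4 → V)
    (hps : (∑ F ∈ (tJoins G Set.univ {a 0, a 1}).filter (fun F : Finset (Sym2 V) =>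
            ¬ (SimpleGraph.fromEdgeSet (↑F : Set (Sym2 V))).Reachable (a 0) (a 2) ∧
            ¬ (SimpleGraph.fromEdgeSet (↑F : Set (Sym2 V))).Reachable (a 0) (a 3)),
          Real.tanh β ^ F.card * isingCorr G (Finset.univ.filter fun v : V =>
            ¬ (SimpleGraph.fromEdgeSet (↑F : Set (Sym2 V))).Reachable (a 0) v) β 0 .free {a 2, a 3})
        = ∑ F ∈ (tJoins G Set.univ (Finset.univ.image a)).filter (fun F : Finset (Sym2 V) =>
            ¬ (SimpleGraph.fromEdgeSet (↑F : Set (Sym2 V))).Reachable (a 0) (a 2) ∧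
            ¬ (SimpleGraph.fromEdgeSet (↑F : Set (Sym2 V))).Reachable (a 0) (a 3)),
          Real.tanh β ^ F.card)
    (htc : (∑ F ∈ (tJoins G Set.univ (Finset.univ.image a)).filter (fun F : Finset (Sym2 V) =>
            ¬ (SimpleGraph.fromEdgeSet (↑F : Set (Sym2 V))).Reachable (a 0) (a 2) ∧
            ¬ (SimpleGraph.fromEdgeSet (↑F : Set (Sym2 V))).Reachable (a 0) (a 3)),
            Real.tanh β ^ F.card) +
      (∑ F ∈ (tJoins G Set.univ (Finset.univ.image a)).filter (fun F : Finset (Sym2 V) =>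
            ¬ (SimpleGraph.fromEdgeSet (↑F : Set (Sym2 V))).Reachable (a 0) (a 1) ∧
            ¬ (SimpleGraph.fromEdgeSet (↑F : Set (Sym2 V))).Reachable (a 0) (a 3)),
            Real.tanh β ^ F.card) +
      (∑ F ∈ (tJoins G Set.univ (Finset.univ.image a)).filter (fun F : Finset (Sym2 V) =>
            ¬ (SimpleGraph.fromEdgeSet (↑F : Set (Sym2 V))).Reachable (a 0) (a 1) ∧
            ¬ (SimpleGraph.fromEdgeSet (↑F : Set (Sym2 V))).Reachable (a 0) (a 2)),
            Real.tanh β ^ F.card)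
        ≤ ∑ F ∈ tJoins G Set.univ (Finset.univ.image a), Real.tanh β ^ F.card)
    (hsym : (let Gc : Fin 4 → Fin 4 → ℝ := fun i j => isingCorr G Finset.univ β 0 .free {a i, a j}
       let C : Fin 4 → Fin 4 → ℝ := fun j k =>
         ∑ F ∈ (tJoins G Set.univ (Finset.univ.image a)).filter (fun F : Finset (Sym2 V) =>
            ¬ (SimpleGraph.fromEdgeSet (↑F : Set (Sym2 V))).Reachable (a 0) (a j) ∧
            ¬ (SimpleGraph.fromEdgeSet (↑F : Set (Sym2 V))).Reachable (a 0) (a k)),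
           Real.tanh β ^ F.card
       Gc 0 2 = Gc 0 1 ∧ Gc 0 3 = Gc 0 1 ∧ Gc 1 3 = Gc 2 3 ∧ Gc 1 2 = Gc 2 3 ∧
         C 1 3 = C 2 3 ∧ C 1 2 = C 2 3))
    (hINT : (let Gc : Fin 4 → Fin 4 → ℝ := fun i j => isingCorr G Finset.univ β 0 .free {a i, a j}
     2 * c * (Gc 0 1 * Gc 2 3) ≤
       Gc 0 1 * Gc 2 3 + Gc 0 2 * Gc 1 3 + Gc 0 3 * Gc 1 2
         - isingCorr G Finset.univ β 0 .free (Finset.univ.image a)))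
    (hJ : (∑ F ∈ (tJoins G Set.univ {a 0, a 1}).filter (fun F : Finset (Sym2 V) =>
            (SimpleGraph.fromEdgeSet (↑F : Set (Sym2 V))).Reachable (a 0) (a 2) ∧
            (SimpleGraph.fromEdgeSet (↑F : Set (Sym2 V))).Reachable (a 0) (a 3)),
          Real.tanh β ^ F.card)
        ≤ κ * (loopO1PartitionFunction G (Real.tanh β) {a 0, a 1} *
            isingCorr G Finset.univ β 0 .free {a 2, a 3})) :
    (∑ F ∈ tJoins G Set.univ {a 0, a 1}, Real.tanh β ^ F.card *
        isingCorr G (Finset.univ.filter fun v : V =>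
          ¬ (SimpleGraph.fromEdgeSet (↑F : Set (Sym2 V))).Reachable (a 0) v) β 0 .free {a 2, a 3})
      ≤ (1 - c / 3) * loopO1PartitionFunction G (Real.tanh β) {a 0, a 1} *
          isingCorr G Finset.univ β 0 .free {a 2, a 3} := by
  -- (1) junk split `LHS = LHS_clean + J` (Disproof §1; `StrandShadowSketch.lhs_decomposition'`,
  --     re-elaborated inline against this module's instances)
  have hL : (∑ F ∈ tJoins G Set.univ {a 0, a 1}, Real.tanh β ^ F.card *
        isingCorr G (Finset.univ.filter fun v : V =>
          ¬ (SimpleGraph.fromEdgeSet (↑F : Set (Sym2 V))).Reachable (a 0) v) β 0 .free {a 2, a 3}) =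
      (∑ F ∈ (tJoins G Set.univ {a 0, a 1}).filter (fun F : Finset (Sym2 V) =>
          ¬ (SimpleGraph.fromEdgeSet (↑F : Set (Sym2 V))).Reachable (a 0) (a 2) ∧
          ¬ (SimpleGraph.fromEdgeSet (↑F : Set (Sym2 V))).Reachable (a 0) (a 3)),
        Real.tanh β ^ F.card * isingCorr G (Finset.univ.filter fun v : V =>
          ¬ (SimpleGraph.fromEdgeSet (↑F : Set (Sym2 V))).Reachable (a 0) v) β 0 .free {a 2, a 3}) +
      ∑ F ∈ (tJoins G Set.univ {a 0, a 1}).filter (fun F : Finset (Sym2 V) =>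
          (SimpleGraph.fromEdgeSet (↑F : Set (Sym2 V))).Reachable (a 0) (a 2) ∧
          (SimpleGraph.fromEdgeSet (↑F : Set (Sym2 V))).Reachable (a 0) (a 3)),
        Real.tanh β ^ F.card := by
    set 𝒯 := tJoins G Set.univ {a 0, a 1}
    set R : Finset (Sym2 V) → V → Prop := fun F v =>
      (SimpleGraph.fromEdgeSet (↑F : Set (Sym2 V))).Reachable (a 0) v with hR
    set f : Finset (Sym2 V) → ℝ := fun F => Real.tanh β ^ F.card *
      isingCorr G (Finset.univ.filter fun v : V => ¬ R F v) β 0 .free {a 2, a 3} with hf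
    have hvol : ∀ (F : Finset (Sym2 V)) (v : V), v ∈ (univ.filter fun w : V => ¬ R F w) ↔ ¬ R F v :=
      fun F v => by simp
    rw [← Finset.sum_filter_add_sum_filter_not 𝒯 (fun F => ¬ R F (a 2) ∧ ¬ R F (a 3)) f]
    congr 1
    rw [← Finset.sum_filter_add_sum_filter_not (𝒯.filter fun F => ¬(¬ R F (a 2) ∧ ¬ R F (a 3)))
      (fun F => R F (a 2) ∧ R F (a 3)) f]
    have hboth : (𝒯.filter fun F => ¬(¬ R F (a 2) ∧ ¬ R F (a 3))).filter
        (fun F => R F (a 2) ∧ R F (a 3)) = 𝒯.filter (fun F => R F (a 2) ∧ R F (a 3)) := by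
      ext F; simp only [Finset.mem_filter]; tauto
    have hzero : ∑ F ∈ (𝒯.filter fun F => ¬(¬ R F (a 2) ∧ ¬ R F (a 3))).filter
        (fun F => ¬ (R F (a 2) ∧ R F (a 3))), f F = 0 := by
      refine Finset.sum_eq_zero fun F hF => ?_
      simp only [Finset.mem_filter] at hF
      obtain ⟨⟨_, hF1⟩, hF2⟩ := hF
      by_cases h2 : R F (a 2)
      · have h3 : ¬ R F (a 3) := fun h3 => hF2 ⟨h2, h3⟩
        simp only [hf]
        rw [StrandShadowSketch.isingCorr_free_pair_eq_zero' G _ β (by simp [h2]) (by simp [h3]),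
          mul_zero]
      · have h3 : R F (a 3) := by
          by_contra h3; exact hF1 ⟨h2, h3⟩
        simp only [hf]
        rw [Finset.pair_comm, StrandShadowSketch.isingCorr_free_pair_eq_zero' G _ β (by simp [h3])
          (by simp [h2]), mul_zero]
    rw [hzero, add_zero, hboth]
    refine Finset.sum_congr rfl fun F hF => ?_
    simp only [Finset.mem_filter] at hF
    simp only [hf]
    have h2 : a 2 ∉ (Finset.univ.filter fun v : V => ¬ R F v) := by
      rw [hvol, not_not]; exact hF.2.1
    have h3 : a 3 ∉ (Finset.univ.filter fun v : V => ¬ R F v) := by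
      rw [hvol, not_not]; exact hF.2.2
    rw [StrandShadowSketch.isingCorr_free_pair_eq_one' G _ β 0 h2 h3, mul_one]
  -- (2) clean part `LHS_clean ≤ (1 - (2/3)c)·Z₀₁·G₂₃` (`StrandShadowSketch.clean_core`, inline)
  simp only at hsym hINT
  obtain ⟨hs02, hs03, hs13, hs12, hsC13, hsC12⟩ := hsym
  have ht : 0 ≤ Real.tanh β := by
    rw [Real.tanh_eq_sinh_div_cosh]
    exact div_nonneg (Real.sinh_nonneg_iff.2 hβ) (Real.cosh_pos _).le
  have hZ0pos : 0 < loopO1PartitionFunction G (Real.tanh β) ∅ :=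
    loopO1PartitionFunction_empty_pos G ht
  have hdict01 := StrandShadowSketch.isingCorr_univ_mul_loopO1_empty G β {a 0, a 1}
  have hdictA : isingCorr G Finset.univ β 0 .free (Finset.univ.image a) *
      loopO1PartitionFunction G (Real.tanh β) ∅ =
        ∑ F ∈ tJoins G Set.univ (Finset.univ.image a), Real.tanh β ^ F.card := by
    rw [StrandShadowSketch.isingCorr_univ_mul_loopO1_empty G β,
      DepletionBound.loopO1PartitionFunction_eq_hteSum, DepletionBound.sum_tJoins_pow_eq_hteSum]
  rw [hs02, hs03, hs13, hs12] at hINT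
  rw [hL, hps]
  set σA := isingCorr G Finset.univ β 0 .free (Finset.univ.image a)
  set G01 := isingCorr G Finset.univ β 0 .free {a 0, a 1}
  set G23 := isingCorr G Finset.univ β 0 .free {a 2, a 3}
  set Z0 := loopO1PartitionFunction G (Real.tanh β) ∅
  set Z01 := loopO1PartitionFunction G (Real.tanh β) {a 0, a 1}
  have hINT' : σA ≤ (3 - 2 * c) * (G01 * G23) := by linarith
  have h3 : 3 * (∑ F ∈ (tJoins G Set.univ (Finset.univ.image a)).filter (fun F : Finset (Sym2 V) =>
      ¬ (SimpleGraph.fromEdgeSet (↑F : Set (Sym2 V))).Reachable (a 0) (a 2) ∧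
      ¬ (SimpleGraph.fromEdgeSet (↑F : Set (Sym2 V))).Reachable (a 0) (a 3)), Real.tanh β ^ F.card)
        ≤ σA * Z0 := by
    rw [hdictA]; linarith [htc, hsC13, hsC12]
  have h4 : σA * Z0 ≤ (3 - 2 * c) * (Z01 * G23) :=
    calc σA * Z0 ≤ (3 - 2 * c) * (G01 * G23) * Z0 := mul_le_mul_of_nonneg_right hINT' hZ0pos.le
      _ = (3 - 2 * c) * (Z01 * G23) := by rw [← hdict01]; ring
  -- (3) junk part and signs
  have hZ01 : 0 ≤ Z01 := loopO1PartitionFunction_nonneg G ht _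
  have hG23 : 0 ≤ G23 := StrandShadowSketch.isingCorr_free_pair_nonneg G Finset.univ hβ (a 2) (a 3)
  have hZG : 0 ≤ Z01 * G23 := mul_nonneg hZ01 hG23
  have hJ' := hJ.trans (mul_le_mul_of_nonneg_right hκ hZG)
  nlinarith [h3, h4, hJ', hZG]

end Assemble

/-- **`StrandShadow` for `l ≥ l₀` from INT and a junk ratio bound.**  If the lattice clause (iii)
holds at the tetrahedron with constant `c` and the junk term satisfies `J ≤ (C/l)·Z₀₁·G₂₃`, then
the formal `StrandShadow` inequality holds with constant `c/3` for every `l ≥ ⌈3C/c⌉ + 1` and all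
large `N` (given the two landed structural facts `hTC` = `stub_threeClean`, `hSY` = `stub_symmetry`,
taken as hypotheses for the reason stated in the module docstring). -/
theorem strandShadow_eventually_of_INT_of_junkRatio
    (hTC : ∀ (V : Type) [Fintype V] [DecidableEq V] (G : SimpleGraph V) [DecidableRel G.Adj] (t : ℝ),
      0 ≤ t → ∀ a : Fin 4 → V,
      (∑ F ∈ (tJoins G Set.univ (Finset.univ.image a)).filter (fun F : Finset (Sym2 V) =>
            ¬ (SimpleGraph.fromEdgeSet (↑F : Set (Sym2 V))).Reachable (a 0) (a 2) ∧
            ¬ (SimpleGraph.fromEdgeSet (↑F : Set (Sym2 V))).Reachable (a 0) (a 3)), t ^ F.card) +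
      (∑ F ∈ (tJoins G Set.univ (Finset.univ.image a)).filter (fun F : Finset (Sym2 V) =>
            ¬ (SimpleGraph.fromEdgeSet (↑F : Set (Sym2 V))).Reachable (a 0) (a 1) ∧
            ¬ (SimpleGraph.fromEdgeSet (↑F : Set (Sym2 V))).Reachable (a 0) (a 3)), t ^ F.card) +
      (∑ F ∈ (tJoins G Set.univ (Finset.univ.image a)).filter (fun F : Finset (Sym2 V) =>
            ¬ (SimpleGraph.fromEdgeSet (↑F : Set (Sym2 V))).Reachable (a 0) (a 1) ∧
            ¬ (SimpleGraph.fromEdgeSet (↑F : Set (Sym2 V))).Reachable (a 0) (a 2)), t ^ F.card)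
        ≤ ∑ F ∈ tJoins G Set.univ (Finset.univ.image a), t ^ F.card)
    (hSY : ∀ (l N : ℕ) (a : Fin 4 → ↥(box 3 N)),
      (∀ i, ((a i : Site 3)) = (l : ℤ) •
        (![![-1, -1, -1], ![1, 1, -1], ![1, -1, 1], ![-1, 1, 1]] : Fin 4 → Site 3) i) →
      ∀ (β t : ℝ),
      (let G := ((zdGraph 3).comap (Subtype.val : ↥(box 3 N) → Site 3))
       let Gc : Fin 4 → Fin 4 → ℝ := fun i j => isingCorr G Finset.univ β 0 .free {a i, a j}
       let C : Fin 4 → Fin 4 → ℝ := fun j k =>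
         ∑ F ∈ (tJoins G Set.univ (Finset.univ.image a)).filter (fun F : Finset (Sym2 ↥(box 3 N)) =>
            ¬ (SimpleGraph.fromEdgeSet (↑F : Set (Sym2 ↥(box 3 N)))).Reachable (a 0) (a j) ∧
            ¬ (SimpleGraph.fromEdgeSet (↑F : Set (Sym2 ↥(box 3 N)))).Reachable (a 0) (a k)),
           t ^ F.card
       Gc 0 2 = Gc 0 1 ∧ Gc 0 3 = Gc 0 1 ∧ Gc 1 3 = Gc 2 3 ∧ Gc 1 2 = Gc 2 3 ∧
         C 1 3 = C 2 3 ∧ C 1 2 = C 2 3))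
    (hINT : ∃ c : ℝ, 0 < c ∧ ∀ l : ℕ, 1 ≤ l → ∃ N₀ : ℕ, ∀ N : ℕ, N₀ ≤ N → ∀ a : Fin 4 → ↥(box 3 N),
      (∀ i, ((a i : Site 3)) = (l : ℤ) •
        (![![-1, -1, -1], ![1, 1, -1], ![1, -1, 1], ![-1, 1, 1]] : Fin 4 → Site 3) i) →
      (let G := ((zdGraph 3).comap (Subtype.val : ↥(box 3 N) → Site 3))
       let β : ℝ := criticalBeta 3
       let Gc : Fin 4 → Fin 4 → ℝ := fun i j => isingCorr G Finset.univ β 0 .free {a i, a j}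
       2 * c * (Gc 0 1 * Gc 2 3) ≤
         Gc 0 1 * Gc 2 3 + Gc 0 2 * Gc 1 3 + Gc 0 3 * Gc 1 2
           - isingCorr G Finset.univ β 0 .free (Finset.univ.image a)))
    (hJR : ∃ C : ℝ, ∀ l : ℕ, 1 ≤ l → ∃ N₀ : ℕ, ∀ N : ℕ, N₀ ≤ N → ∀ a : Fin 4 → ↥(box 3 N),
      (∀ i, ((a i : Site 3)) = (l : ℤ) •
        (![![-1, -1, -1], ![1, 1, -1], ![1, -1, 1], ![-1, 1, 1]] : Fin 4 → Site 3) i) →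
      (let G := ((zdGraph 3).comap (Subtype.val : ↥(box 3 N) → Site 3))
       let β : ℝ := criticalBeta 3
       let t : ℝ := Real.tanh β
       (∑ F ∈ (tJoins G Set.univ {a 0, a 1}).filter (fun F : Finset (Sym2 ↥(box 3 N)) =>
            (SimpleGraph.fromEdgeSet (↑F : Set (Sym2 ↥(box 3 N)))).Reachable (a 0) (a 2) ∧
            (SimpleGraph.fromEdgeSet (↑F : Set (Sym2 ↥(box 3 N)))).Reachable (a 0) (a 3)),
          t ^ F.card)
         ≤ C / l * (loopO1PartitionFunction G t {a 0, a 1} *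
             isingCorr G Finset.univ β 0 .free {a 2, a 3}))) :
    ∃ c : ℝ, 0 < c ∧ ∃ l₀ : ℕ, 1 ≤ l₀ ∧ ∀ l : ℕ, l₀ ≤ l → ∃ N₀ : ℕ, ∀ N : ℕ, N₀ ≤ N →
      ∀ a : Fin 4 → ↥(box 3 N),
      (∀ i, ((a i : Site 3)) = (l : ℤ) •
        (![![-1, -1, -1], ![1, 1, -1], ![1, -1, 1], ![-1, 1, 1]] : Fin 4 → Site 3) i) →
      (let G := ((zdGraph 3).comap (Subtype.val : ↥(box 3 N) → Site 3))
       let β : ℝ := criticalBeta 3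
       let t : ℝ := Real.tanh β
       (∑ F ∈ tJoins G Set.univ {a 0, a 1}, t ^ F.card *
           isingCorr G (Finset.univ.filter fun v : ↥(box 3 N) =>
             ¬ (SimpleGraph.fromEdgeSet (↑F : Set (Sym2 ↥(box 3 N)))).Reachable (a 0) v)
             β 0 .free {a 2, a 3})
         ≤ (1 - c) * loopO1PartitionFunction G t {a 0, a 1} *
             isingCorr G Finset.univ β 0 .free {a 2, a 3}) := by
  obtain ⟨c, hc, hI⟩ := hINT
  obtain ⟨C, hJ⟩ := hJR
  refine ⟨c / 3, by positivity, ⌈3 * C / c⌉₊ + 1, Nat.le_add_left 1 _, fun l hl => ?_⟩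
  have hl1 : 1 ≤ l := le_trans (Nat.le_add_left 1 _) hl
  have hlpos : (0 : ℝ) < l := by exact_mod_cast hl1
  -- `C / l ≤ c / 3` for `l ≥ ⌈3C/c⌉ + 1`
  have hCl : C / l ≤ c / 3 := by
    rw [div_le_iff₀ hlpos]
    have h1 : (⌈3 * C / c⌉₊ : ℝ) + 1 ≤ l := by exact_mod_cast hl
    have h2 : 3 * C / c ≤ ⌈3 * C / c⌉₊ := Nat.le_ceil _
    have h3 : 3 * C / c * (c / 3) = C := by field_simp
    nlinarith [h1, h2, h3, hc]
  obtain ⟨N₁, hN₁⟩ := hI l hl1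
  obtain ⟨N₂, hN₂⟩ := hJ l hl1
  refine ⟨max N₁ N₂, fun N hN a ha => ?_⟩
  have hint := hN₁ N (le_of_max_le_left hN) a ha
  have hjr := hN₂ N (le_of_max_le_right hN) a ha
  have hsym := hSY l N a ha (criticalBeta 3) (Real.tanh (criticalBeta 3))
  simp only at hint hjr hsym ⊢
  have hβ : 0 ≤ criticalBeta 3 := criticalBeta_nonneg 3
  have ht : 0 ≤ Real.tanh (criticalBeta 3) := by
    rw [Real.tanh_eq_sinh_div_cosh]
    exact div_nonneg (Real.sinh_nonneg_iff.2 hβ) (Real.cosh_pos _).le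
  have hps := StrandShadowSketch.stub_pairSplit ↥(box 3 N)
    ((zdGraph 3).comap (Subtype.val : ↥(box 3 N) → Site 3)) (criticalBeta 3) a
  have htc := hTC ↥(box 3 N)
    ((zdGraph 3).comap (Subtype.val : ↥(box 3 N) → Site 3)) (Real.tanh (criticalBeta 3)) ht a
  have key := evINT_assemble (c := c) (κ := C / l)
    ((zdGraph 3).comap (Subtype.val : ↥(box 3 N) → Site 3)) hβ hCl a
    (by convert hps using 12) (by convert htc using 12) (by convert hsym using 12)
    (by convert hint using 12) (by convert hjr using 12)
  convert key using 12

end Summit.CriticalPhenomena.Ising3DConformalLimit.Theorems.StrandShadowOddCut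

end
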